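import Mathlib.Analysis.PSeries
import Literature.NumberTheory.LFunctions.PrimeNumberTheoremProgressions
import HarnessLib

/-!
# `∑_{p ≡ a (q)} 1/p` diverges; large prime sums `∑_{p ≡ a (q), p > y} p^{-σ}` for `σ` near `1`

Topic `Literature/NumberTheory/LFunctions` (namespace `Literature.NumberTheory.LFunctions`).
Everything here is PROVED, from the tree's prime number theorem for arithmetic progressions
(`Literature.NumberTheory.LFunctions.sum_log_prime_residue_isLittleO`:
`θ(X; q, a) = X/φ(q) + o(X)`).

* `exists_sum_Ioc_prime_residue_one_div_ge` — **Dirichlet–Mertens, qualitative**: for a unit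
  `a mod q`, any `y` and any `K`, some `X` has `∑_{y < p ≤ X, p ≡ a (q)} 1/p ≥ K` (dyadic blocks
  `(X, 2X]` carry `≥ X/(2φ(q))` of `θ`, hence `≥ 1/(4φ(q) log 2X)` of `∑ 1/p`, and the harmonic
  series diverges);
* `exists_forall_le_tsum_prime_residue_rpow` — the input of Saias–Weingartner 2009, Lemma 1
  ("Using the prime number theorem for arithmetic progressions, we readily find that there exists
  an `η > 0`, such that for each `1 < σ ≤ 1 + η` and `1 ≤ a ≤ q`, `(a, q) = 1`, we have
  `S_a ≥ 10 ‖C⁻¹‖_∞ R`", `S_a(q, y, σ) = ∑_{p > y, p ≡ a (q)} p^{-σ}`): for every `K` there is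
  `η > 0` with `K ≤ ∑_{p > y, p ≡ a (q)} p^{-σ}` for all units `a` and all `1 < σ ≤ 1 + η`.

## References

* [SaiasWeingartner2009] E. Saias, A. Weingartner, *Zeros of Dirichlet series with periodic
  coefficients*, Acta Arith. 140 (2009), 335–344, Lemma 1 (proof), read (arXiv:0807.0783, p. 6).
* [MontgomeryVaughan2007] H. L. Montgomery, R. C. Vaughan, *Multiplicative Number Theory I*,
  Cor. 11.17 (main term), the source of the tree's PNT for progressions.
-/

noncomputable section

open Filter Asymptotics Finset

namespace Literature.NumberTheory.LFunctions

/-! ### Dyadic blocks of primes in a residue class -/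

section Dyadic

variable {q : ℕ} [NeZero q] {a : ZMod q}

omit [NeZero q] in
/-- The `θ`-sum of a residue class over `(X, 2X]` is the difference of the sums over `[1, 2X]` and
`[1, X]`. [folklore] -/
theorem sum_Ioc_eq_sub (a : ZMod q) (g : ℕ → ℝ) (X : ℕ) :
    ∑ p ∈ Ioc X (2 * X) with p.Prime ∧ ((p : ℕ) : ZMod q) = a, g p =
      ∑ p ∈ Icc 1 (2 * X) with p.Prime ∧ ((p : ℕ) : ZMod q) = a, g p -
        ∑ p ∈ Icc 1 X with p.Prime ∧ ((p : ℕ) : ZMod q) = a, g p := by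
  rw [eq_sub_iff_add_eq, ← sum_union]
  · congr 1
    ext p
    simp only [mem_union, mem_filter, mem_Ioc, mem_Icc]
    constructor
    · rintro (⟨⟨h1, h2⟩, hp⟩ | ⟨⟨h1, h2⟩, hp⟩)
      · exact ⟨⟨by omega, h2⟩, hp⟩
      · exact ⟨⟨h1, by omega⟩, hp⟩
    · rintro ⟨⟨h1, h2⟩, hp⟩
      by_cases h : X < p
      · exact Or.inl ⟨⟨h, h2⟩, hp⟩
      · exact Or.inr ⟨⟨h1, by omega⟩, hp⟩
  · rw [disjoint_left]
    intro p hp hp'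
    simp only [mem_filter, mem_Ioc, mem_Icc] at hp hp'
    omega

/-- **A dyadic block carries `≥ X/(2φ(q))` of `θ(·; q, a)` for large `X`** (from
`θ(X; q, a) = X/φ(q) + o(X)` with tolerance `X/(8φ(q))`). [folklore] -/
theorem eventually_le_sum_Ioc_log (ha : IsUnit a) :
    ∀ᶠ X : ℕ in atTop, (X : ℝ) / (2 * q.totient) ≤
      ∑ p ∈ Ioc X (2 * X) with p.Prime ∧ ((p : ℕ) : ZMod q) = a, Real.log p := by
  have hφ : 0 < (q.totient : ℝ) := by exact_mod_cast Nat.totient_pos.2 (NeZero.pos q)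
  have h := sum_log_prime_residue_isLittleO ha
  have hc : (0 : ℝ) < (q.totient : ℝ)⁻¹ / 8 := by positivity
  have h1 := h.def hc
  have h2 : ∀ᶠ X : ℕ in atTop, ‖∑ p ∈ Icc 1 (2 * X) with p.Prime ∧ ((p : ℕ) : ZMod q) = a,
      Real.log p - (q.totient : ℝ)⁻¹ * (2 * X : ℕ)‖ ≤ (q.totient : ℝ)⁻¹ / 8 * ‖((2 * X : ℕ) : ℝ)‖ :=
    (tendsto_id.const_mul_atTop' two_pos).eventually h1
  filter_upwards [h1, h2] with X hX h2X
  rw [sum_Ioc_eq_sub]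
  rw [Real.norm_eq_abs, Real.norm_eq_abs, Nat.abs_cast] at hX h2X
  have hX' := (abs_le.1 hX).2
  have h2X' := (abs_le.1 h2X).1
  push_cast at h2X' ⊢
  rw [div_le_iff₀ (by positivity)]
  have e1 : (q.totient : ℝ)⁻¹ * (q.totient : ℝ) = 1 := inv_mul_cancel₀ hφ.ne'
  nlinarith [e1, hX', h2X', hφ, (Nat.cast_nonneg X : (0 : ℝ) ≤ X)]

/-- **A dyadic block carries `≥ 1/(4φ(q) log 2X)` of `∑ 1/p`**, for large `X`. [folklore] -/
theorem eventually_le_sum_Ioc_one_div (ha : IsUnit a) :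
    ∀ᶠ X : ℕ in atTop, 1 / (4 * q.totient * Real.log (2 * X)) ≤
      ∑ p ∈ Ioc X (2 * X) with p.Prime ∧ ((p : ℕ) : ZMod q) = a, (1 : ℝ) / p := by
  have hφ : 0 < (q.totient : ℝ) := by exact_mod_cast Nat.totient_pos.2 (NeZero.pos q)
  filter_upwards [eventually_le_sum_Ioc_log ha, eventually_ge_atTop 1] with X hX hX1
  have hX0 : (0 : ℝ) < X := by exact_mod_cast hX1
  have hlog : 0 < Real.log (2 * X) := Real.log_pos (by
    have : (1 : ℝ) ≤ X := by exact_mod_cast hX1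
    linarith)
  -- termwise: `log p / (2X log 2X) ≤ 1/p` on the block
  have hterm : ∀ p ∈ (Ioc X (2 * X)).filter (fun p ↦ p.Prime ∧ ((p : ℕ) : ZMod q) = a),
      Real.log p / (2 * X * Real.log (2 * X)) ≤ (1 : ℝ) / p := by
    intro p hp
    simp only [mem_filter, mem_Ioc] at hp
    obtain ⟨⟨hp1, hp2⟩, hpp, -⟩ := hp
    have hp0 : (0 : ℝ) < p := by exact_mod_cast hpp.pos
    have hp2' : (p : ℝ) ≤ 2 * X := by exact_mod_cast hp2
    have hlogp : Real.log p ≤ Real.log (2 * X) := Real.log_le_log hp0 hp2'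
    have hlogp0 : 0 ≤ Real.log p := Real.log_nonneg (by exact_mod_cast hpp.one_lt.le)
    rw [div_le_div_iff₀ (by positivity) hp0, one_mul]
    calc Real.log p * p ≤ Real.log (2 * X) * (2 * X) :=
          mul_le_mul hlogp hp2' hp0.le hlog.le
      _ = 2 * X * Real.log (2 * X) := by ring
  calc 1 / (4 * q.totient * Real.log (2 * X))
      = (X / (2 * q.totient)) / (2 * X * Real.log (2 * X)) := by
        field_simp
        ring
    _ ≤ (∑ p ∈ Ioc X (2 * X) with p.Prime ∧ ((p : ℕ) : ZMod q) = a, Real.log p) /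
          (2 * X * Real.log (2 * X)) := by gcongr
    _ = ∑ p ∈ Ioc X (2 * X) with p.Prime ∧ ((p : ℕ) : ZMod q) = a,
          Real.log p / (2 * X * Real.log (2 * X)) := by rw [sum_div]
    _ ≤ _ := sum_le_sum hterm

/-- **`∑_{p ≡ a (q)} 1/p` diverges** (Dirichlet): for every `y` and `K` there is `X ≥ y` with
`∑_{y < p ≤ X, p ≡ a (q)} 1/p ≥ K`. [folklore] -/
theorem exists_sum_Ioc_prime_residue_one_div_ge (ha : IsUnit a) (y : ℕ) (K : ℝ) :
    ∃ X : ℕ, y ≤ X ∧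
      K ≤ ∑ p ∈ Ioc y X with p.Prime ∧ ((p : ℕ) : ZMod q) = a, (1 : ℝ) / p := by
  have hφ : 0 < (q.totient : ℝ) := by exact_mod_cast Nat.totient_pos.2 (NeZero.pos q)
  obtain ⟨X₀, hX₀⟩ := eventually_atTop.1 (eventually_le_sum_Ioc_one_div ha)
  -- the base point `X₁ ≥ max X₀ y 2` and the dyadic points `2^j X₁`
  set X₁ : ℕ := max (max X₀ y) 2 with hX₁
  have hX₁0 : X₀ ≤ X₁ := (le_max_left _ _).trans (le_max_left _ _)
  have hX₁y : y ≤ X₁ := (le_max_right _ _).trans (le_max_left _ _)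
  have hX₁2 : 2 ≤ X₁ := le_max_right _ _
  set M : ℝ := max (Real.log 2) (Real.log X₁) with hM
  have hM2 : Real.log 2 ≤ M := le_max_left _ _
  have hM0 : 0 < M := lt_of_lt_of_le (Real.log_pos one_lt_two) hM2
  -- block bound at `2^j X₁`
  have hblock : ∀ j : ℕ, 1 / (4 * q.totient * M * (j + 2)) ≤
      ∑ p ∈ Ioc (2 ^ j * X₁) (2 * (2 ^ j * X₁)) with p.Prime ∧ ((p : ℕ) : ZMod q) = a,
        (1 : ℝ) / p := by
    intro j
    have hle : X₀ ≤ 2 ^ j * X₁ := hX₁0.trans (Nat.le_mul_of_pos_left _ (by positivity))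
    refine le_trans ?_ (hX₀ _ hle)
    have hlog : Real.log (2 * ((2 ^ j * X₁ : ℕ) : ℝ)) ≤ M * (j + 2) := by
      have hX₁pos : (0 : ℝ) < X₁ := by exact_mod_cast (by omega : 0 < X₁)
      push_cast
      rw [show (2 : ℝ) * (2 ^ j * X₁) = 2 ^ (j + 1) * X₁ by ring,
        Real.log_mul (by positivity) hX₁pos.ne', Real.log_pow]
      push_cast
      nlinarith [hM2, (le_max_right _ _ : Real.log X₁ ≤ M), Real.log_pos one_lt_two,
        (Nat.cast_nonneg j : (0 : ℝ) ≤ j)]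
    have hlogpos : 0 < Real.log (2 * ((2 ^ j * X₁ : ℕ) : ℝ)) := Real.log_pos (by
      have : (2 : ℝ) ≤ ((2 ^ j * X₁ : ℕ) : ℝ) := by
        exact_mod_cast hX₁2.trans (Nat.le_mul_of_pos_left _ (by positivity))
      linarith)
    rw [div_le_div_iff₀ (by positivity) (by positivity), one_mul, one_mul]
    calc 4 * (q.totient : ℝ) * Real.log (2 * ((2 ^ j * X₁ : ℕ) : ℝ))
        ≤ 4 * (q.totient : ℝ) * (M * (j + 2)) := mul_le_mul_of_nonneg_left hlog (by positivity)
      _ = _ := by ring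
  -- the telescoping sum over the blocks `j < J` is the sum over `(X₁, 2^J X₁]`
  have hunion : ∀ J : ℕ, ∑ j ∈ range J,
      ∑ p ∈ Ioc (2 ^ j * X₁) (2 * (2 ^ j * X₁)) with p.Prime ∧ ((p : ℕ) : ZMod q) = a,
        (1 : ℝ) / p =
      ∑ p ∈ Ioc X₁ (2 ^ J * X₁) with p.Prime ∧ ((p : ℕ) : ZMod q) = a, (1 : ℝ) / p := by
    intro J
    induction J with
    | zero => simp
    | succ J ih =>
      rw [sum_range_succ, ih, ← sum_union]
      · congr 1
        ext p
        simp only [mem_union, mem_filter, mem_Ioc]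
        have h1 : X₁ ≤ 2 ^ J * X₁ := Nat.le_mul_of_pos_left _ (by positivity)
        have h2 : 2 * (2 ^ J * X₁) = 2 ^ (J + 1) * X₁ := by ring
        constructor
        · rintro (⟨⟨hp1, hp2⟩, hp⟩ | ⟨⟨hp1, hp2⟩, hp⟩)
          · exact ⟨⟨hp1, hp2.trans (by rw [← h2]; omega)⟩, hp⟩
          · exact ⟨⟨by omega, by omega⟩, hp⟩
        · rintro ⟨⟨hp1, hp2⟩, hp⟩
          by_cases h : p ≤ 2 ^ J * X₁
          · exact Or.inl ⟨⟨hp1, h⟩, hp⟩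
          · exact Or.inr ⟨⟨by omega, by rw [h2]; exact hp2⟩, hp⟩
      · rw [disjoint_left]
        intro p hp hp'
        simp only [mem_filter, mem_Ioc] at hp hp'
        omega
  -- harmonic divergence: choose `J` with `∑_{j<J} 1/(j+2) ≥ 4 φ M K`
  have hharm : Tendsto (fun J : ℕ ↦ ∑ j ∈ range J, (1 : ℝ) / (j + 2)) atTop atTop := by
    have h := (Real.tendsto_sum_range_one_div_nat_succ_atTop).const_mul_atTop
      (by norm_num : (0 : ℝ) < 1 / 2)
    refine tendsto_atTop_mono (fun J ↦ ?_) h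
    rw [mul_sum]
    refine sum_le_sum fun j _ ↦ ?_
    have hj : (0 : ℝ) ≤ j := Nat.cast_nonneg j
    calc (1 : ℝ) / 2 * (1 / (j + 1)) = 1 / (2 * j + 2) := by field_simp
      _ ≤ 1 / (j + 2) := one_div_le_one_div_of_le (by positivity) (by linarith)
  obtain ⟨J, hJ⟩ := (tendsto_atTop.1 hharm (4 * q.totient * M * K)).exists
  refine ⟨2 ^ J * X₁, hX₁y.trans (Nat.le_mul_of_pos_left _ (by positivity)), ?_⟩
  -- compare
  have hsub : ∑ p ∈ Ioc X₁ (2 ^ J * X₁) with p.Prime ∧ ((p : ℕ) : ZMod q) = a, (1 : ℝ) / p ≤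
      ∑ p ∈ Ioc y (2 ^ J * X₁) with p.Prime ∧ ((p : ℕ) : ZMod q) = a, (1 : ℝ) / p := by
    refine sum_le_sum_of_subset_of_nonneg (fun p hp ↦ ?_) fun _ _ _ ↦ by positivity
    simp only [mem_filter, mem_Ioc] at hp ⊢
    exact ⟨⟨by omega, hp.1.2⟩, hp.2⟩
  refine le_trans ?_ hsub
  rw [← hunion]
  calc K = (1 / (4 * q.totient * M)) * (4 * q.totient * M * K) := by field_simp
    _ ≤ (1 / (4 * q.totient * M)) * ∑ j ∈ range J, (1 : ℝ) / (j + 2) :=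
        mul_le_mul_of_nonneg_left hJ (by positivity)
    _ = ∑ j ∈ range J, 1 / (4 * q.totient * M * (j + 2)) := by
        rw [mul_sum]
        refine sum_congr rfl fun j _ ↦ ?_
        field_simp
    _ ≤ _ := sum_le_sum fun j _ ↦ hblock j

end Dyadic

/-! ### The prime sums `S_a(q, y, σ) = ∑_{p > y, p ≡ a (q)} p^{-σ}` near `σ = 1` -/

/-- The summand of `S_a(q, y, σ)`, as a function on `ℕ` supported on the primes `p > y` of the
class `a`. [cite: SaiasWeingartner2009, Lemma 1 (proof)] -/
theorem summable_prime_residue_rpow {q : ℕ} (a : ZMod q) (y : ℕ) {σ : ℝ} (hσ : 1 < σ) :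
    Summable fun n : ℕ ↦
      if n.Prime ∧ y < n ∧ ((n : ℕ) : ZMod q) = a then (n : ℝ) ^ (-σ) else 0 := by
  refine (Real.summable_nat_rpow.2 (by linarith : -σ < -1)).of_nonneg_of_le (fun n ↦ ?_)
    fun n ↦ ?_
  · split_ifs <;> positivity
  · split_ifs
    · exact le_rfl
    · positivity

/-- **Large prime sums in progressions for `σ` near `1`** (the input of Saias–Weingartner's
Lemma 1: "there exists an `η > 0`, such that for each `1 < σ ≤ 1 + η` and `1 ≤ a ≤ q`,
`(a, q) = 1`, we have `S_a ≥ 10‖C⁻¹‖_∞ R`"): for every `K` there is `η > 0` such that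
`K ≤ ∑_{p > y, p ≡ a (q)} p^{-σ}` for every unit `a mod q` and every `1 < σ ≤ 1 + η`.
[cite: SaiasWeingartner2009, Lemma 1 (proof)] -/
theorem exists_forall_le_tsum_prime_residue_rpow (q : ℕ) [NeZero q] (y : ℕ) (K : ℝ) :
    ∃ η : ℝ, 0 < η ∧ ∀ σ : ℝ, 1 < σ → σ ≤ 1 + η → ∀ a : ZMod q, IsUnit a →
      K ≤ ∑' n : ℕ, if n.Prime ∧ y < n ∧ ((n : ℕ) : ZMod q) = a then (n : ℝ) ^ (-σ) else 0 := by
  classical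
  -- for each unit class an `X_a` with `∑_{y < p ≤ X_a} 1/p ≥ 2K`, then one `X` for all
  have hX : ∀ a : ZMod q, ∃ X : ℕ, 2 ≤ X ∧ (IsUnit a →
      2 * K ≤ ∑ p ∈ Ioc y X with p.Prime ∧ ((p : ℕ) : ZMod q) = a, (1 : ℝ) / p) := by
    intro a
    by_cases ha : IsUnit a
    · obtain ⟨X, -, hX⟩ := exists_sum_Ioc_prime_residue_one_div_ge ha y (2 * K)
      refine ⟨max X 2, le_max_right _ _, fun _ ↦ hX.trans ?_⟩
      refine sum_le_sum_of_subset_of_nonneg (fun p hp ↦ ?_) fun _ _ _ ↦ by positivity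
      simp only [mem_filter, mem_Ioc] at hp ⊢
      exact ⟨⟨hp.1.1, hp.1.2.trans (le_max_left _ _)⟩, hp.2⟩
    · exact ⟨2, le_rfl, fun h ↦ (ha h).elim⟩
  choose X hX2 hXK using hX
  set Xm : ℕ := Finset.univ.sup X with hXm
  have hXle : ∀ a, X a ≤ Xm := fun a ↦ Finset.le_sup (f := X) (Finset.mem_univ a)
  have hXm2 : (2 : ℝ) ≤ Xm := by
    have : 2 ≤ Xm := (hX2 0).trans (hXle 0)
    exact_mod_cast this
  have hlogXm : 0 < Real.log Xm := Real.log_pos (by linarith)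
  -- `η = log 2 / log Xm`: then `p^{-(σ-1)} ≥ Xm^{-η} = 1/2` for `p ≤ Xm`
  refine ⟨Real.log 2 / Real.log Xm, by positivity, fun σ hσ1 hση a ha ↦ ?_⟩
  have hsum := summable_prime_residue_rpow a y hσ1
  have hfin : ∑ p ∈ Ioc y Xm with p.Prime ∧ ((p : ℕ) : ZMod q) = a,
      (if p.Prime ∧ y < p ∧ ((p : ℕ) : ZMod q) = a then (p : ℝ) ^ (-σ) else 0) ≤
      ∑' n : ℕ, if n.Prime ∧ y < n ∧ ((n : ℕ) : ZMod q) = a then (n : ℝ) ^ (-σ) else 0 :=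
    hsum.sum_le_tsum _ fun n _ ↦ by split_ifs <;> positivity
  refine le_trans ?_ hfin
  -- on the block, the summand is `p^{-σ} ≥ (1/2) (1/p)`
  have hterm : ∀ p ∈ (Ioc y Xm).filter (fun p ↦ p.Prime ∧ ((p : ℕ) : ZMod q) = a),
      (1 / 2) * ((1 : ℝ) / p) ≤
        (if p.Prime ∧ y < p ∧ ((p : ℕ) : ZMod q) = a then (p : ℝ) ^ (-σ) else 0) := by
    intro p hp
    simp only [mem_filter, mem_Ioc] at hp
    obtain ⟨⟨hp1, hp2⟩, hpp, hpa⟩ := hp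
    rw [if_pos ⟨hpp, hp1, hpa⟩]
    have hp0 : (0 : ℝ) < p := by exact_mod_cast hpp.pos
    have hpX : (p : ℝ) ≤ Xm := by exact_mod_cast hp2
    -- `p^{-σ} = p^{-1} · p^{-(σ-1)}` and `p^{-(σ-1)} ≥ Xm^{-(σ-1)} ≥ Xm^{-η} = 1/2`
    have h1 : (p : ℝ) ^ (-σ) = (1 / p) * (p : ℝ) ^ (-(σ - 1)) := by
      rw [show -σ = -1 + -(σ - 1) by ring, Real.rpow_add hp0, Real.rpow_neg_one, one_div]
    have h2 : (Xm : ℝ) ^ (-(σ - 1)) ≤ (p : ℝ) ^ (-(σ - 1)) :=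
      Real.rpow_le_rpow_of_nonpos hp0 hpX (by linarith)
    have h3 : (1 : ℝ) / 2 ≤ (Xm : ℝ) ^ (-(σ - 1)) := by
      have hη : σ - 1 ≤ Real.log 2 / Real.log Xm := by linarith
      have hXm0 : (0 : ℝ) < Xm := by linarith
      rw [Real.rpow_neg hXm0.le, one_div, inv_le_inv₀ two_pos (Real.rpow_pos_of_pos hXm0 _)]
      calc (Xm : ℝ) ^ (σ - 1) ≤ (Xm : ℝ) ^ (Real.log 2 / Real.log Xm) :=
            Real.rpow_le_rpow_of_exponent_le (by linarith) hη
        _ = 2 := by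
            rw [Real.rpow_def_of_pos hXm0, show Real.log Xm * (Real.log 2 / Real.log Xm) =
              Real.log 2 by field_simp, Real.exp_log two_pos]
    rw [h1]
    calc 1 / 2 * (1 / (p : ℝ)) = (1 / p) * (1 / 2) := by ring
      _ ≤ (1 / p) * (p : ℝ) ^ (-(σ - 1)) :=
          mul_le_mul_of_nonneg_left (h3.trans h2) (by positivity)
  calc K = (1 / 2) * (2 * K) := by ring
    _ ≤ (1 / 2) * ∑ p ∈ Ioc y Xm with p.Prime ∧ ((p : ℕ) : ZMod q) = a, (1 : ℝ) / p := by
        refine mul_le_mul_of_nonneg_left ((hXK a ha).trans ?_) (by norm_num)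
        refine sum_le_sum_of_subset_of_nonneg (fun p hp ↦ ?_) fun _ _ _ ↦ by positivity
        simp only [mem_filter, mem_Ioc] at hp ⊢
        exact ⟨⟨hp.1.1, hp.1.2.trans (hXle a)⟩, hp.2⟩
    _ = ∑ p ∈ Ioc y Xm with p.Prime ∧ ((p : ℕ) : ZMod q) = a, (1 / 2) * ((1 : ℝ) / p) := by
        rw [mul_sum]
    _ ≤ _ := sum_le_sum hterm

end Literature.NumberTheory.LFunctions
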